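import Literature.ModelTheory.ExponentialFields.DefinablyCompleteRolleCount
import HarnessLib

/-!
# Partial derivatives and the mean value formula in `Kⁿ` over a definably complete ordered field

Topic `Literature/ModelTheory/ExponentialFields`.  First-order (`C¹`) calculus of definable
functions `f : Kⁿ → K` on a definably complete ordered field `K`, the setting of the models of
`OEF ∪ [DC]` (Fornasiero–Servi, *Definably complete Baire structures*, Fund. Math. 209 (2010),
§1.2: "most results of elementary real analysis can be proved in every definably complete
expansion of an ordered field"; their §§3–8 and Wilkie's proofs use `C¹` maps `Kⁿ → Kᵐ`,
Jacobians and the implicit function theorem throughout).  No norm is available, so everything is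
phrased with coordinates and the `ℓ¹`-size `Σ |hᵢ|`:

* `HasPartialDerivAt f i d x` — the `i`-th partial derivative at `x` is `d`: the field
  derivative (`HasFieldDerivAt`, `DefinablyCompleteCalculus.lean`) of `t ↦ f (update x i t)`
  at `x i`;
* `HasLinDerivAt f g x` — `f` is differentiable at `x` with gradient `g`:
  `|f (x + h) - f x - Σ gᵢ hᵢ| ≤ ε Σ |hᵢ|` for `|hᵢ| < δ(ε)`;
* **`IsDefinablyComplete.exists_sub_eq_sum_partial_mul`** — the *mean value formula*: if the
  partial derivatives `pᵢ` exist on the box spanned by `x` and `y`, then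
  `f y - f x = Σᵢ pᵢ(ξᵢ) (yᵢ - xᵢ)` for points `ξᵢ` of that box (telescoping over the
  coordinates and the one-variable definable mean value theorem on each edge);
* **`IsDefinablyComplete.abs_sub_le_mul_sum_abs_sub`** — the mean value inequality
  `|f y - f x| ≤ M Σ |yᵢ - xᵢ|` under `|pᵢ| ≤ M` on the box;
* **`IsDefinablyComplete.hasLinDerivAt_of_continuous_partial`** — *continuous partial
  derivatives give differentiability*: if the `pᵢ` exist on a sup-ball around `x` and are
  continuous at `x` (sup-ball form), then `HasLinDerivAt f (fun i => pᵢ x) x`.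

Everything is proved; the definitions are the two differentiability predicates.  Hypotheses
`hlt`, `hadd`, `hmul` (graphs of `<`, `+`, `·` definable) and `hf : DefinableFun f` as in the
other definable-calculus files.

## References

* A. Fornasiero, T. Servi, *Definably complete Baire structures*, Fund. Math. 209 (2010),
  §1.2. [FornasieroServi2010]
* C. Miller, *Expansions of dense linear orders with the intermediate value property*,
  J. Symbolic Logic 66 (2001). [Miller2001]
-/

open Set FirstOrder FirstOrder.Language Function
open _root_.Filter _root_.Topology

namespace Literature.ModelTheory.ExponentialFields

universe u v

/-! ### Partial derivatives and differentiability -/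

section Defs

variable {K : Type*} [Field K] [TopologicalSpace K] {n : ℕ}

/-- **The `i`-th partial derivative** of `f : Kⁿ → K` at `x` is `d`: the one-variable field
derivative of `t ↦ f(x₁, …, t, …, xₙ)` (`t` in the `i`-th slot) at `t = xᵢ`.  A definition.
[folklore] -/
def HasPartialDerivAt (f : (Fin n → K) → K) (i : Fin n) (d : K) (x : Fin n → K) : Prop :=
  HasFieldDerivAt (fun t => f (update x i t)) d (x i)

variable [LinearOrder K]

/-- **Differentiability with gradient `g`** of `f : Kⁿ → K` at `x`, in an ordered field without
a norm: for every `ε > 0` there is `δ > 0` with `|f (x + h) - f x - Σ gᵢ hᵢ| ≤ ε · Σ |hᵢ|`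
whenever `|hᵢ| < δ` for all `i`.  A definition. [folklore] -/
def HasLinDerivAt (f : (Fin n → K) → K) (g : Fin n → K) (x : Fin n → K) : Prop :=
  ∀ ε : K, 0 < ε → ∃ δ : K, 0 < δ ∧ ∀ h : Fin n → K, (∀ i, |h i| < δ) →
    |f (x + h) - f x - ∑ i, g i * h i| ≤ ε * ∑ i, |h i|

omit [LinearOrder K] in
/-- Unfolding lemma. [folklore] -/
theorem hasPartialDerivAt_iff {f : (Fin n → K) → K} {i : Fin n} {d : K} {x : Fin n → K} :
    HasPartialDerivAt f i d x ↔ HasFieldDerivAt (fun t => f (update x i t)) d (x i) := Iff.rfl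

end Defs

/-! ### The mean value formula -/

section MeanValue

variable {K : Type*} [Field K] [LinearOrder K] [IsStrictOrderedRing K] [TopologicalSpace K]
  [OrderTopology K] {L : FirstOrder.Language.{u, v}} [L.Structure K] {n : ℕ}

omit [Field K] [TopologicalSpace K] [OrderTopology K] [LinearOrder K] [IsStrictOrderedRing K] in
/-- The one-variable slice `t ↦ f (update z i t)` of a definable `f` has a definable graph.
[folklore] -/
theorem definable_graph_slice {f : (Fin n → K) → K} (hf : (univ : Set K).DefinableFun L f)
    (z : Fin n → K) (i : Fin n) :
    (univ : Set K).Definable L {v : Fin 2 → K | v 1 = f (update z i (v 0))} := by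
  classical
  refine definable_graph_of_definableFun (g := fun t => f (update z i t)) ?_
  refine hf.comp fun j => ?_
  by_cases hj : j = i
  · subst hj
    simpa using definableFun_proj_params (L := L) (A := (univ : Set K)) (0 : Fin 2)
  · simpa [update_of_ne hj] using
      definableFun_const_params (L := L) (A := (univ : Set K)) (Fin 2) (mem_univ (z j))

/-- **One edge of the mean value formula**: along the `i`-th coordinate, from `z` (with
`z i = s`) to `update z i t`, the increment of `f` is `pᵢ(ξ) (t - s)` for some `ξ` on the edge,
provided the `i`-th partial derivative exists along the closed edge (one-variable definable
mean value theorem, `DefinablyCompleteCalculus.lean`). [folklore] -/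
theorem _root_.FirstOrder.Language.IsDefinablyComplete.exists_edge_increment
    (hDC : L.IsDefinablyComplete K)
    (hlt : (univ : Set K).Definable L {v : Fin 2 → K | v 0 < v 1})
    (hadd : (univ : Set K).Definable L {v : Fin 3 → K | v 2 = v 0 + v 1})
    (hmul : (univ : Set K).Definable L {v : Fin 3 → K | v 2 = v 0 * v 1})
    {f : (Fin n → K) → K} (hf : (univ : Set K).DefinableFun L f) {p : (Fin n → K) → K}
    (z : Fin n → K) (i : Fin n) (s t : K)
    (hder : ∀ r, min s t ≤ r → r ≤ max s t → HasPartialDerivAt f i (p (update z i r)) (update z i r)) :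
    ∃ r, min s t ≤ r ∧ r ≤ max s t ∧
      f (update z i t) - f (update z i s) = p (update z i r) * (t - s) := by
  rcases eq_or_ne s t with rfl | hst
  · exact ⟨s, min_le_left _ _, le_max_left _ _, by simp⟩
  -- the slice `g r = f (update z i r)` and its derivative `p (update z i r)`
  set g : K → K := fun r => f (update z i r) with hg
  have hgder : ∀ r, min s t ≤ r → r ≤ max s t → HasFieldDerivAt g (p (update z i r)) r := by
    intro r h1 h2
    have h := hder r h1 h2
    rw [hasPartialDerivAt_iff] at h
    simpa [hg, update_idem] using h
  have hcont : ContinuousOn g (Icc (min s t) (max s t)) := fun r hr =>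
    (hgder r hr.1 hr.2).continuousAt.continuousWithinAt
  have hlo : min s t < max s t := min_lt_max.2 hst
  obtain ⟨c, hc, hcslope⟩ := hDC.exists_hasFieldDerivAt_eq_slope hlt hadd hmul
    (definable_graph_slice hf z i) hlo hcont (fun r hr => hgder r hr.1.le hr.2.le)
  refine ⟨c, hc.1.le, hc.2.le, ?_⟩
  have hne : max s t - min s t ≠ 0 := sub_ne_zero.2 hlo.ne'
  rcases le_total s t with h | h
  · rw [min_eq_left h, max_eq_right h] at hcslope hne
    rw [hcslope, div_mul_cancel₀ _ hne]
  · rw [min_eq_right h, max_eq_left h] at hcslope hne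
    have : g s - g t = p (update z i c) * (s - t) := by rw [hcslope, div_mul_cancel₀ _ hne]
    simp only [hg] at this
    linear_combination -this

/-- **The mean value formula in `Kⁿ`**: if the partial derivatives `pᵢ` of the definable
function `f` exist at every point of the closed box spanned by `x` and `y`, then
`f y - f x = Σᵢ pᵢ(ξᵢ) · (yᵢ - xᵢ)` for some points `ξᵢ` of that box (move from `x` to `y` one
coordinate at a time and apply the one-variable definable mean value theorem on each edge).
[folklore] -/
theorem _root_.FirstOrder.Language.IsDefinablyComplete.exists_sub_eq_sum_partial_mul
    (hDC : L.IsDefinablyComplete K)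
    (hlt : (univ : Set K).Definable L {v : Fin 2 → K | v 0 < v 1})
    (hadd : (univ : Set K).Definable L {v : Fin 3 → K | v 2 = v 0 + v 1})
    (hmul : (univ : Set K).Definable L {v : Fin 3 → K | v 2 = v 0 * v 1})
    {f : (Fin n → K) → K} (hf : (univ : Set K).DefinableFun L f) {p : Fin n → (Fin n → K) → K}
    (x y : Fin n → K)
    (hder : ∀ w : Fin n → K, (∀ j, min (x j) (y j) ≤ w j ∧ w j ≤ max (x j) (y j)) →
      ∀ i, HasPartialDerivAt f i (p i w) w) :
    ∃ ξ : Fin n → (Fin n → K), (∀ i j, min (x j) (y j) ≤ ξ i j ∧ ξ i j ≤ max (x j) (y j)) ∧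
      f y - f x = ∑ i, p i (ξ i) * (y i - x i) := by
  classical
  -- the intermediate points `z k`: the first `k` coordinates from `y`, the others from `x`
  let z : ℕ → (Fin n → K) := fun k j => if (j : ℕ) < k then y j else x j
  have hz0 : z 0 = x := by funext j; simp [z]
  have hzn : z n = y := by funext j; simp [z, j.isLt]
  have hzbox : ∀ k j, min (x j) (y j) ≤ z k j ∧ z k j ≤ max (x j) (y j) := by
    intro k j
    by_cases h : (j : ℕ) < k
    · simp only [z, h, if_true]; exact ⟨min_le_right _ _, le_max_right _ _⟩
    · simp only [z, h, if_false]; exact ⟨min_le_left _ _, le_max_left _ _⟩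
  have hzi : ∀ i : Fin n, z i i = x i := fun i => by simp [z]
  have hzsucc : ∀ i : Fin n, z (i + 1) = update (z i) i (y i) := by
    intro i
    funext j
    by_cases hj : j = i
    · subst hj; simp [z]
    · rw [update_of_ne hj]
      have hne : (j : ℕ) ≠ i := fun h => hj (Fin.ext h)
      simp only [z]
      by_cases h1 : (j : ℕ) < i
      · simp [h1, Nat.lt_succ_of_lt h1]
      · have h2 : ¬ (j : ℕ) < i + 1 := by omega
        simp [h1, h2]
  -- each edge
  have hedge : ∀ i : Fin n, ∃ r, min (x i) (y i) ≤ r ∧ r ≤ max (x i) (y i) ∧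
      f (z (i + 1)) - f (z i) = p i (update (z i) i r) * (y i - x i) := by
    intro i
    have h := hDC.exists_edge_increment hlt hadd hmul hf (p := p i) (z i) i (x i) (y i)
      (fun r h1 h2 => hder _ (fun j => ?_) i)
    · obtain ⟨r, h1, h2, heq⟩ := h
      refine ⟨r, h1, h2, ?_⟩
      rw [hzsucc i, ← heq, ← hzi i, update_eq_self]
    · by_cases hj : j = i
      · subst hj; simpa using And.intro h1 h2
      · rw [update_of_ne hj]; exact hzbox _ _
  choose r hr1 hr2 hreq using hedge
  refine ⟨fun i => update (z i) i (r i), fun i j => ?_, ?_⟩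
  · dsimp only
    by_cases hj : j = i
    · subst hj; simpa using And.intro (hr1 j) (hr2 j)
    · rw [update_of_ne hj]; exact hzbox _ _
  · -- telescoping
    have htel : ∑ i : Fin n, (f (z (i + 1)) - f (z i)) = f y - f x := by
      rw [Fin.sum_univ_eq_sum_range (fun k => f (z (k + 1)) - f (z k)) n,
        Finset.sum_range_sub (fun k => f (z k)) n, hzn, hz0]
    rw [← htel]
    exact Finset.sum_congr rfl fun i _ => hreq i

/-- **The mean value inequality in `Kⁿ`**: with `|pᵢ| ≤ M` on the box spanned by `x` and `y`,
`|f y - f x| ≤ M · Σ |yᵢ - xᵢ|`. [folklore] -/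
theorem _root_.FirstOrder.Language.IsDefinablyComplete.abs_sub_le_mul_sum_abs_sub
    (hDC : L.IsDefinablyComplete K)
    (hlt : (univ : Set K).Definable L {v : Fin 2 → K | v 0 < v 1})
    (hadd : (univ : Set K).Definable L {v : Fin 3 → K | v 2 = v 0 + v 1})
    (hmul : (univ : Set K).Definable L {v : Fin 3 → K | v 2 = v 0 * v 1})
    {f : (Fin n → K) → K} (hf : (univ : Set K).DefinableFun L f) {p : Fin n → (Fin n → K) → K}
    (x y : Fin n → K)
    (hder : ∀ w : Fin n → K, (∀ j, min (x j) (y j) ≤ w j ∧ w j ≤ max (x j) (y j)) →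
      ∀ i, HasPartialDerivAt f i (p i w) w)
    {M : K} (hM : ∀ w : Fin n → K, (∀ j, min (x j) (y j) ≤ w j ∧ w j ≤ max (x j) (y j)) →
      ∀ i, |p i w| ≤ M) :
    |f y - f x| ≤ M * ∑ i, |y i - x i| := by
  obtain ⟨ξ, hξ, heq⟩ := hDC.exists_sub_eq_sum_partial_mul hlt hadd hmul hf x y hder
  rw [heq, Finset.mul_sum]
  refine (Finset.abs_sum_le_sum_abs _ _).trans (Finset.sum_le_sum fun i _ => ?_)
  rw [abs_mul]
  exact mul_le_mul_of_nonneg_right (hM _ (hξ i) i) (abs_nonneg _)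

/-- **Continuous partial derivatives give differentiability**: if the partial derivatives
`pᵢ` of the definable `f` exist on a sup-ball `{w | ∀ j, |wⱼ - xⱼ| < ρ}` and are continuous at
`x` in the sup-ball sense, then `f` is differentiable at `x` with gradient `(pᵢ x)ᵢ`
(mean value formula on the box spanned by `x` and `x + h`). [folklore] -/
theorem _root_.FirstOrder.Language.IsDefinablyComplete.hasLinDerivAt_of_continuous_partial
    (hDC : L.IsDefinablyComplete K)
    (hlt : (univ : Set K).Definable L {v : Fin 2 → K | v 0 < v 1})
    (hadd : (univ : Set K).Definable L {v : Fin 3 → K | v 2 = v 0 + v 1})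
    (hmul : (univ : Set K).Definable L {v : Fin 3 → K | v 2 = v 0 * v 1})
    {f : (Fin n → K) → K} (hf : (univ : Set K).DefinableFun L f) {p : Fin n → (Fin n → K) → K}
    {x : Fin n → K} {ρ : K} (hρ : 0 < ρ)
    (hder : ∀ w : Fin n → K, (∀ j, |w j - x j| < ρ) → ∀ i, HasPartialDerivAt f i (p i w) w)
    (hpc : ∀ i, ∀ ε : K, 0 < ε → ∃ δ : K, 0 < δ ∧ ∀ w : Fin n → K, (∀ j, |w j - x j| < δ) →
      |p i w - p i x| ≤ ε) :
    HasLinDerivAt f (fun i => p i x) x := by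
  classical
  intro ε hε
  -- a common `δ ≤ ρ` for all coordinates
  have hδi : ∀ i, ∃ δ : K, 0 < δ ∧ ∀ w : Fin n → K, (∀ j, |w j - x j| < δ) → |p i w - p i x| ≤ ε :=
    fun i => hpc i ε hε
  choose δ hδpos hδ using hδi
  rcases isEmpty_or_nonempty (Fin n) with hn | hn
  · refine ⟨ρ, hρ, fun h _ => ?_⟩
    have h0 : h = 0 := funext fun i => (hn.false i).elim
    subst h0
    simp
  set δ₀ : K := min ρ (Finset.univ.inf' Finset.univ_nonempty δ) with hδ₀
  have hδ₀pos : 0 < δ₀ := lt_min hρ ((Finset.lt_inf'_iff _).2 fun i _ => hδpos i)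
  have hδ₀ρ : δ₀ ≤ ρ := min_le_left _ _
  have hδ₀δ : ∀ i, δ₀ ≤ δ i := fun i =>
    (min_le_right _ _).trans (Finset.inf'_le _ (Finset.mem_univ i))
  refine ⟨δ₀, hδ₀pos, fun h hh => ?_⟩
  -- the box spanned by `x` and `x + h` lies in the sup-ball of radius `δ₀`
  have hbox : ∀ w : Fin n → K, (∀ j, min (x j) ((x + h) j) ≤ w j ∧ w j ≤ max (x j) ((x + h) j)) →
      ∀ j, |w j - x j| < δ₀ := by
    intro w hw j
    have h1 := (hw j).1
    have h2 := (hw j).2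
    simp only [Pi.add_apply] at h1 h2
    have hhj := abs_lt.1 (hh j)
    rw [abs_sub_lt_iff]
    constructor
    · rcases le_total 0 (h j) with hs | hs
      · rw [max_eq_right (by linarith)] at h2; linarith
      · rw [max_eq_left (by linarith)] at h2; linarith
    · rcases le_total 0 (h j) with hs | hs
      · rw [min_eq_left (by linarith)] at h1; linarith
      · rw [min_eq_right (by linarith)] at h1; linarith
  obtain ⟨ξ, hξ, heq⟩ := hDC.exists_sub_eq_sum_partial_mul hlt hadd hmul hf x (x + h)
    (fun w hw i => hder w (fun j => (hbox w hw j).trans_le hδ₀ρ) i)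
  have hξ' : ∀ i, |p i (ξ i) - p i x| ≤ ε := fun i =>
    hδ i (ξ i) fun j => (hbox (ξ i) (hξ i) j).trans_le (hδ₀δ i)
  have hcalc : f (x + h) - f x - ∑ i, p i x * h i = ∑ i, (p i (ξ i) - p i x) * h i := by
    rw [heq, ← Finset.sum_sub_distrib]
    refine Finset.sum_congr rfl fun i _ => ?_
    simp only [Pi.add_apply]
    ring
  rw [hcalc, Finset.mul_sum]
  refine (Finset.abs_sum_le_sum_abs _ _).trans (Finset.sum_le_sum fun i _ => ?_)
  rw [abs_mul]
  exact mul_le_mul_of_nonneg_right (hξ' i) (abs_nonneg _)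

end MeanValue

end Literature.ModelTheory.ExponentialFields
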